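import Literature.NumberTheory.EllipticCurves.Rank1Residual.Predicates
import Literature.NumberTheory.EllipticCurves.Isogeny
import HarnessLib

/-!
# Ribet's lemma for an elliptic curve over `ℚ` at a good Eisenstein prime: the isogeny class
# contains a member whose `p`-torsion is the NON-SPLIT extension with the `p`-RAMIFIED character as
# its (unique) rational line — a named fact

HONEST FRAMING (cell `bsd-eis`, home `run/shared/lean/pub/bsd-eis/`; FULL-BSD rank-≤1 programme,
row A1). This file vendors ONE published statement as a named fact (`def … : Prop`, nothing
asserted) in the cell's predicate vocabulary. Seat `bsd-eis-ky` (prover,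
Keller–Yin verification), gen 3; memo `HOME/bsd-eis-ky-MEMO-3.md` §5 R2. It is the existence, in
every isogeny class of the cell's class X1, of Keller–Yin's "good lattice" (their Prop. 1.3.1
`omega first non-split`), the member on which the cell's THEOREM A is proved
(`Summits/…/X1/KellerYinTheoremA.lean`); with it THEOREM A becomes a statement about the CENSUS curve.
A kernel proof (the `p`-isogeny graph of the class has a leaf with `p`-ramified kernel; plan in the
memo: quotient by the maximal Γ_ℚ-stable cyclic subgroup of `E[p^∞]` through the unramified line,
`finite_isogenyClass_holds`) is the better road and is left to the successor; until then the
statement enters as this CITED fact.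

## Sources and the composition (three printed, published steps)

1. **Ribet's lemma** — K. Ribet, *A modular construction of unramified `p`-extensions of
   `ℚ(μ_p)`*, Invent. Math. **34** (1976) 151–162, **Prop. (2.1), p. 154** (primary text: GDZ OCR
   of record `HOME/lit/src/ribet76-gdz/`, verbatim in `HOME/LIT-DOSSIER.md` §14: "Suppose that the
   `K`-representation `ρ` is simple but that its reductions are reducible. Let `φ₁` and `φ₂` be the
   characters associated to the reductions of `ρ`. Then `G` leaves stable some lattice `L ⊂ V` for
   which the associated reduction is of the form `(φ₁ *; 0 φ₂)` but is not semi-simple" — `G` any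
   group leaving a lattice stable, the labels `φ₁, φ₂` arbitrary); restated in the exposition
   arXiv:0903.2617 (p. 4, held `paper:arxiv-0903.2617` p0004 L95–103): "PROPOSITION 2.1 (“Ribet's
   lemma”). Suppose that the degree-`2` representation `V` of `G` is simple but `ρ̄` is not simple.
   Then, for any ordering `φ₁, φ₂` of the two characters of which `ρ̄` is the direct sum, there is a
   `G`-stable `𝔬`-lattice `Λ ⊂ V` such that `ρ_Λ ∼ (φ₁ *; 0 φ₂)`, as opposed to `(φ₁ 0; * φ₂)`, and
   such that `ρ_Λ` is not semisimple, i.e., `ρ_Λ ≁ φ₁ ⊕ φ₂`." (`G` compact, `𝔬` the integers of a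
   finite extension `K/ℚ_p`, `V` a `2`-dimensional `K[G]`-module, `ρ̄` = the semisimplified
   reduction.) REFEREED / PUBLISHED. Bib key `Ribet1976`.
2. **`V_p E` is a simple `ℚ_p[Γ_ℚ]`-module for every elliptic curve `E/ℚ`** — Faltings, Invent.
   Math. **73** (1983), §5 "Endomorphismen", p. 360–361 (Satz 3: `π = Γ_K` acts semisimply on
   `T_l(A) ⊗ ℚ_l`; Satz 4: `End_K(A) ⊗ ℤ_l ≅ End_π(T_l(A))`, Korollar 1 the `Hom`-version; hence
   `V_p E` semisimple with `End_{Γ_ℚ}(V_p E) = End_ℚ(E) ⊗ ℚ_p`; GDZ text `HOME/lit/src/faltings83-gdz/`),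
   and `End_ℚ(E) = ℤ` for `E/ℚ` (the complex multiplications of a CM curve are not defined over `ℚ`;
   Silverman *AEC* III.9 / C.11), so `End_{Γ_ℚ}(V_p E) = ℚ_p` and the semisimple `V_p E` is simple.
   (For non-CM `E` also Serre 1972.) Bib keys `Faltings1983Endlichkeit`, `SilvermanAEC2009`.
3. **Lattices ↔ isogenous curves** — a `Γ_ℚ`-stable `ℤ_p`-lattice `Λ ⊃ T_p E` of finite index in
   `V_p E` is `T_p E'` for the quotient `E' = E/(Λ/T_pE)` by the finite `Γ_ℚ`-stable subgroup
   `Λ/T_p E ⊂ E[p^∞]` (Silverman *AEC* III.4.12 with Rem. III.4.13.2: a finite `Γ_ℚ`-stable subgroup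
   is the kernel of an isogeny defined over `ℚ`; tree theorem
   `WeierstrassCurve.exists_isogeny_ker_eq_and_comp_eq_nsmul_holds`), and every lattice is homothetic
   to one containing `T_p E`; then `E'[p] ≅ Λ/pΛ` as `Γ_ℚ`-modules, i.e. `ρ̄_{E'} = ρ_Λ`.

Composition, at a GOOD prime `p > 2` with `E[p]` reducible: `E` is ordinary at `p` (tree theorem
`Rank1Residual.goodOrd_of_red_of_good`, Serre 1972), so on an inertia group at `p` the two characters
of `E[p]^{ss}` are `{ω|_{I_p}, 𝟙}` (`E[p]|_{I_p} ≅ (ω *; 0 1)` by the connected–étale sequence,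
*AEC* VII / Serre 1972 §1.11) — exactly ONE of the two global characters, call it `φ₁`, is ramified
at `p`. Ribet's lemma with the ordering (`φ₁` sub, `φ₂` quotient) gives a lattice `Λ`, hence (3) an
isogenous `E'` with `E'[p]` a NON-SPLIT extension `0 → 𝔽_p(φ₁) → E'[p] → 𝔽_p(φ₂) → 0`. A non-split
`2`-dimensional `𝔽_p[Γ_ℚ]`-module with a stable line has exactly one stable line; so EVERY rational
`p`-line of `E'` is `𝔽_p(φ₁)`, whose character is ramified at `p`: in the cell's predicates
(`Rank1Residual/Predicates.lean`: `IsRationalLine`, `LineUnramifiedAt` = every inertia group above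
`p` acts trivially), **no rational `p`-line of `E'` is unramified at `p`**. This is Keller–Yin's
normalisation (arXiv:2402.12781v2 Prop. 1.3.1 / §1.4 eq. (char to f): "`ρ̄_f|_{G_K}` non-split … with
`φ̃|_{G_{K_v}} = ω`"), there obtained by the same citation ("By Ribet's Lemma [Bellaïche]").

The transcription below states the CONCLUSION of that composition for a globally minimal `W/ℚ`
(the isogenous curve is taken with a globally minimal model — Néron, *AEC* VIII.8.3, tree
`hasGlobalMinimalModel_rat_holds`; `IsIsogenous` is invariant under admissible changes of variables):
weaker than print (Ribet's lemma gives both orderings and works for any compact `G`), never stronger.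

## Contents
* `ribet_exists_isIsogenous_noUnramifiedLine` — the named fact (ONE `def … : Prop`; no consumers here —
  the consumer is `Summits/…/X1/KellerYinTheoremAClass.lean`).

## References
* [Ribet1976] K. A. Ribet, Invent. Math. 34 (1976) 151–162, Prop. (2.1) p. 154 (primary text: GDZ OCR `HOME/lit/src/ribet76-gdz/`, canvas 160; HOME/LIT-DOSSIER.md §14; restated in arXiv:0903.2617 p. 4).
* [Faltings1983Endlichkeit] G. Faltings, Invent. Math. 73 (1983), §5 Satz 3, Satz 4, Korollar 1 (p. 360–361).
* [SilvermanAEC2009] J. Silverman, *AEC* 2nd ed., III.4.12, III.4.13.2, III.7, III.9, VII.2–VII.3, VIII.8.3.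
* [Serre1972] J.-P. Serre, Invent. Math. 15 (1972), §1.11 (ordinary `E[p]|_{I_p}`), §4.
* [KellerYin2024] T. Keller, M. Yin, arXiv:2402.12781v2, §0.2 (L262–L266), Prop. 1.3.1, §1.4 (L1077–L1086).
* HOME/bsd-eis-ky-MEMO-1.md §0 ("good lattice"), §2 L1–L2; HOME/bsd-eis-ky-MEMO-3.md §5 R2.
-/

set_option autoImplicit false

noncomputable section

open scoped Classical

open WeierstrassCurve Literature.NumberTheory.EllipticCurves
  Literature.NumberTheory.EllipticCurves.Rank1Residual

namespace Literature.NumberTheory.EllipticCurves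

/-- **Ribet's lemma for an elliptic curve over `ℚ` at a good Eisenstein prime `p > 2`** (Ribet,
Invent. Math. 34 (1976), Prop. 2.1: "Suppose that the degree-`2` representation `V` of `G` is simple
but `ρ̄` is not simple. Then, for any ordering `φ₁, φ₂` of the two characters of which `ρ̄` is the
direct sum, there is a `G`-stable `𝔬`-lattice `Λ ⊂ V` such that `ρ_Λ ∼ (φ₁ *; 0 φ₂)` … and such that
`ρ_Λ` is not semisimple", applied to `V = V_p E`, which is simple (Faltings 1983 §5 Satz 3–4 with
`End_ℚ(E) = ℤ`), with `φ₁` := the one of the two characters of `E[p]^{ss}` that is ramified at `p`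
(`E` is ordinary at a good Eisenstein `p > 2`, `E[p]|_{I_p} ≅ (ω *; 0 1)`); the lattice is `T_p E'` for
an isogenous `E'` (*AEC* III.4.12 / Rem. III.4.13.2), whose `E'[p]` is then the NON-SPLIT extension of
`𝔽_p(φ₂)` by `𝔽_p(φ₁)`, so that its only rational `p`-line is the `p`-RAMIFIED one. TRANSCRIBED (module
docstring for the composition): for `W/ℚ` globally minimal elliptic, `2 < p`, `Good W p`, `Red W p`,
there is a globally minimal elliptic `W'`, `ℚ`-isogenous to `W` (`IsIsogenous W W'`), such that NO
rational `p`-line of `W'` is unramified at `p` (`∀ Φ, IsRationalLine W' p Φ → ¬ LineUnramifiedAt W' p Φ`)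
— Keller–Yin's "good lattice" (arXiv:2402.12781v2 Prop. 1.3.1, §1.4). Weaker than print (one ordering;
`G = Γ_ℚ`, `𝔬 = ℤ_p`). PUBLISHED ingredients only; a kernel proof from `finite_isogenyClass_holds` is
the intended replacement (memo MEMO-3 §5 R2).
[cite: Ribet1976, Prop. (2.1), p. 154 (verbatim above; restated in arXiv:0903.2617 p. 4)]
[cite: Faltings1983Endlichkeit, §5 Satz 3 and Satz 4 with Korollar 1, p. 360–361 (V_p E semisimple; End_ℚ E ⊗ ℤ_p ≅ End_{Γ_ℚ} T_p E)]
[cite: SilvermanAEC2009, Prop. III.4.12 with Rem. III.4.13.2 (quotient by a finite Γ_ℚ-stable subgroup), VIII.8.3 (global minimal model)]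
[cite: KellerYin2024, Prop. 1.3.1 and §1.4 (arXiv:2402.12781v2 L877–L885, L1077–L1086) (the same normalisation, "by Ribet's Lemma")] -/
def ribet_exists_isIsogenous_noUnramifiedLine : Prop :=
  ∀ (W : WeierstrassCurve ℚ) [W.IsElliptic] [W.IsGloballyMinimal] (p : ℕ) [Fact p.Prime],
    2 < p → Good W p → Red W p →
    ∃ (W' : WeierstrassCurve ℚ) (_ : W'.IsElliptic) (_ : W'.IsGloballyMinimal),
      IsIsogenous W W' ∧
        ∀ Φ : AddSubgroup (geomTorsion W' (p : ℤ)), IsRationalLine W' p Φ → ¬ LineUnramifiedAt W' p Φ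

end Literature.NumberTheory.EllipticCurves

end
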